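import Summits.Ventures.DiscreteObjects.PP12.FanoFiveSignProfile
import Summits.Ventures.DiscreteObjects.PP12.FanoFiveSignReduction

/-!
# PP(12), order 5: the order-5 cell reduces to a CODING statement about sixteen sign vectors of length 7 (kernel)
Framing: lottery ticket; floor = certified bounds/negative ranges.

Cell pub-namedobj (venture DiscreteObjects), target (M), designs gen 17. Assembling `FanoFiveSignParity` / `FanoFiveSignProfile` (designs g10
FAMILY-P5PLANE §4, now kernel theorems) with `FanoFiveSignReduction`:
* `FanoFive.IsECode E` — sixteen sign vectors `E_O ∈ {±1}⁷` with balanced columns, pairwise distinct, all of the same weight parity, from EVERY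
  row exactly `2 / 9 / 4` other rows at inner product `−5 / −1 / 3` (Hamming distance `6 / 4 / 2`), and all column-pair correlations in `{0, ±4}`;
  this is the hypothesis of designs g10's `code/p5plane/codeB.c` (there: even-weight words of `F₂⁷` — complement all words if the common parity is
  odd —, per-point distance profile `(4, 9, 2)`, `|column correlation| ≤ 4`; `codeB` found NO such 16-set: ONE engine, `7·10⁸` nodes, outside the kernel);
* **`IsSignSystem.isECode`**: every solution of designs g10's sign/Gram system (for a labelled Fano incidence `I`) has `IsECode E`
  (the correlations: `⟨ε_x, ε_y⟩ = −2 Σ_μ m(x,μ) m(y,μ)` and exactly two lines avoid both `x` and `y`);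
* **`noSignSystem_of_noECode`**, **`noOrderFive_of_noECode`**: `NoECode → NoSignSystem I → NoOrderFiveOrder12`; `card_collineationGroup_eq_one_v16`
  (rigid endgame with the order-5 hypothesis `NoECode`).
So the order-5 cell of PP(12) has TWO finite certificates outside the kernel, each behind a kernel reduction: designs g10's full system (engines
1 / 1c / 2, two implementations) and the much smaller coding statement `NoECode` (one implementation so far — a second one is a successor item;
`2^{112}` sign matrices: no `decide`). Nothing here asserts either. No `sorry`, no new axioms.
-/

namespace Summit.Ventures.DiscreteObjects.PP12

open Finset

namespace FanoFive

/-- **The coding statement behind the order-5 cell** (designs g10 `codeB.c`): sixteen sign vectors of length `7`, balanced, distinct, of one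
weight parity, with distance profile `(4, 9, 2)` from every row and column-pair correlations in `{0, ±4}`. -/
structure IsECode (E : Fin 16 → Fin 7 → ℤ) : Prop where
  /-- sign entries -/
  sign : ∀ O x, E O x = 1 ∨ E O x = -1
  /-- balanced columns -/
  balanced : ∀ x, ∑ O, E O x = 0
  /-- pairwise distinct rows -/
  rows_ne : ∀ O O', O ≠ O' → E O ≠ E O'
  /-- all rows have the same weight parity -/
  parity : ∀ O O', (wt E O : ℤ) % 2 = (wt E O' : ℤ) % 2
  /-- exactly two rows at inner product `−5` (distance `6`) from every row -/
  six : ∀ O, (univ.filter fun X => ∑ x, E O x * E X x = -5).card = 2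
  /-- exactly nine rows at inner product `−1` (distance `4`) from every row -/
  four : ∀ O, (univ.filter fun X => ∑ x, E O x * E X x = -1).card = 9
  /-- exactly four rows at inner product `3` (distance `2`) from every row -/
  two : ∀ O, (univ.filter fun X => ∑ x, E O x * E X x = 3).card = 4
  /-- column-pair correlations in `{0, ±4}` -/
  corr : ∀ x y, x ≠ y → ∑ O, E O x * E O y = 0 ∨ ∑ O, E O x * E O y = 4 ∨ ∑ O, E O x * E O y = -4

/-- **census statement at the coding level (typed; decided EMPTY outside the kernel by ONE engine, designs g10 `codeB.c`)** -/
def NoECode : Prop := ∀ E : Fin 16 → Fin 7 → ℤ, ¬ IsECode E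

/-- in a labelled Fano plane exactly two lines avoid two given distinct points -/
theorem card_lines_avoiding_two {I : Fin 7 → Fin 7 → Bool} (hI : IsIncidence I) {x y : Fin 7} (hxy : x ≠ y) :
    (univ.filter fun μ => I x μ = false ∧ I y μ = false).card = 2 := by
  have h3x := hI.1 x
  have h3y := hI.1 y
  have h1 := hI.2.2 x y hxy
  have hu := Finset.card_union_add_card_inter (univ.filter fun μ => I x μ = true) (univ.filter fun μ => I y μ = true)
  rw [← Finset.filter_or, ← Finset.filter_and, h3x, h3y, h1] at hu
  have hc := Finset.card_filter_add_card_filter_not (s := (univ : Finset (Fin 7))) (fun μ => I x μ = true ∨ I y μ = true)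
  simp only [card_univ, Fintype.card_fin] at hc
  have e : (univ.filter fun μ => ¬(I x μ = true ∨ I y μ = true)) = univ.filter fun μ => I x μ = false ∧ I y μ = false := by
    ext μ; simp [not_or]
  rw [e] at hc
  omega

namespace IsSignSystem

variable {I : Fin 7 → Fin 7 → Bool} {m : Fin 7 → Fin 7 → ℤ} {E Es : Fin 16 → Fin 7 → ℤ} {R : Fin 16 → Fin 16 → ℤ}

/-- `(M Mᵀ)_{xy} ∈ {0, ±2}` for `x ≠ y`: the sum of the two signs products on the lines avoiding `x` and `y` -/
theorem sum_m_mul_m_mem (hI : IsIncidence I) (h : IsSignSystem I m E Es R) {x y : Fin 7} (hxy : x ≠ y) :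
    ∑ μ, m x μ * m y μ = 0 ∨ ∑ μ, m x μ * m y μ = 2 ∨ ∑ μ, m x μ * m y μ = -2 := by
  obtain ⟨μ₁, μ₂, hne, hs⟩ := Finset.card_eq_two.1 (card_lines_avoiding_two hI hxy)
  have hmem : ∀ μ, (I x μ = false ∧ I y μ = false) ↔ μ = μ₁ ∨ μ = μ₂ := fun μ => by
    have : μ ∈ (univ.filter fun ν => I x ν = false ∧ I y ν = false) ↔ μ ∈ ({μ₁, μ₂} : Finset (Fin 7)) := by rw [hs]
    simpa using this
  have e : ∑ μ, m x μ * m y μ = ∑ μ ∈ ({μ₁, μ₂} : Finset (Fin 7)), m x μ * m y μ := by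
    symm
    refine Finset.sum_subset (Finset.subset_univ _) fun μ _ hμ => ?_
    cases hx : I x μ
    · cases hy : I y μ
      · exfalso
        apply hμ
        rcases (hmem μ).1 ⟨hx, hy⟩ with rfl | rfl <;> simp
      · rw [h.m_flag y μ hy, mul_zero]
    · rw [h.m_flag x μ hx, zero_mul]
  rw [e, Finset.sum_pair hne]
  have h1 : I x μ₁ = false ∧ I y μ₁ = false := (hmem μ₁).2 (Or.inl rfl)
  have h2 : I x μ₂ = false ∧ I y μ₂ = false := (hmem μ₂).2 (Or.inr rfl)
  rcases h.m_antiflag x μ₁ h1.1 with a | a <;> rcases h.m_antiflag y μ₁ h1.2 with b | b <;>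
    rcases h.m_antiflag x μ₂ h2.1 with c | c <;> rcases h.m_antiflag y μ₂ h2.2 with d | d <;> norm_num [a, b, c, d]

/-- column-pair correlations of `E` are in `{0, ±4}` -/
theorem corr_mem (hI : IsIncidence I) (h : IsSignSystem I m E Es R) {x y : Fin 7} (hxy : x ≠ y) :
    ∑ O, E O x * E O y = 0 ∨ ∑ O, E O x * E O y = 4 ∨ ∑ O, E O x * E O y = -4 := by
  have hg := h.gram_E x y
  rw [if_neg hxy] at hg
  rcases sum_m_mul_m_mem hI h hxy with e | e | e <;> rw [e] at hg <;> omega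

/-- **every solution of designs g10's sign/Gram system yields an E-code** -/
theorem isECode (hI : IsIncidence I) (h : IsSignSystem I m E Es R) : IsECode E where
  sign := h.E_sign
  balanced := h.E_balanced
  rows_ne := h.E_rows_ne
  parity := wt_parity h
  six := card_inner_neg_five h
  four := card_inner_neg_one h
  two := card_inner_three h
  corr := fun _ _ hxy => corr_mem hI h hxy

end IsSignSystem

/-- **`NoECode → NoSignSystem I`** for every labelled Fano incidence `I` -/
theorem noSignSystem_of_noECode {I : Fin 7 → Fin 7 → Bool} (hI : IsIncidence I) (h0 : NoECode) : NoSignSystem I :=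
  fun _ E _ _ h => h0 E (h.isECode hI)

end FanoFive

/-- **The order-5 cell of PP(12) from the coding statement.** -/
theorem noOrderFive_of_noECode (h0 : FanoFive.NoECode) : NoOrderFiveOrder12 :=
  noOrderFive_of_noSignSystem FanoFive.isIncidence_stdI (FanoFive.noSignSystem_of_noECode FanoFive.isIncidence_stdI h0)

/-- `NoECode → NoFanoFiveIncMatrix` (all labellings) -/
theorem noFanoFiveIncMatrix_of_noECode (h0 : FanoFive.NoECode) : NoFanoFiveIncMatrix :=
  noFanoFiveIncMatrix_of_noSignSystem FanoFive.isIncidence_stdI (FanoFive.noSignSystem_of_noECode FanoFive.isIncidence_stdI h0)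

open Literature.Combinatorics.Designs Summit.Ventures.DiscreteObjects.STD in
/-- **Rigid endgame, v16 (the order-5 hypothesis is the coding statement `NoECode`).** -/
theorem card_collineationGroup_eq_one_v16 (h2 : NoLiftableSTD2_12_6) (h3E : NoLiftableSTD3_12_4)
    (h4 : NoFlagOrbitMatrix 4) (h3 : NoFlagOrbitMatrix 3) (h7 : NoFlagSevenOrbitMatrix) (h10 : NoFlagTenOrbitMatrix)
    (h5 : FanoFive.NoECode) (h11 : NoCollineationOfOrderEleven) (h13 : NoLiftData13)
    (P L : Type) [Membership P L] [Fintype P] [Fintype L] [Configuration.ProjectivePlane P L] (h12 : Configuration.ProjectivePlane.order P L = 12)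
    (G : Type) [Group G] [Fintype G] [MulAction G P] [MulAction G L] (hG : IsCollineationGroup G P L) :
    Fintype.card G = 1 :=
  card_collineationGroup_eq_one_v13 h2 h3E h4 h3 h7 h10 (noFanoFiveIncMatrix_of_noECode h5) h11 h13 P L h12 G hG

end Summit.Ventures.DiscreteObjects.PP12
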